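import Summits.QuantumFields.QCD.Theorems.QuarksAsStableActionStableActionBridgeCyclicSupertraceFlavour
import Literature.MathematicalPhysics.QuantumFieldTheory.QCDPhaseQuenchedReweighting
import Literature.MathematicalPhysics.QuantumFieldTheory.TorusFreeTransfer
import Literature.MathematicalPhysics.QuantumFieldTheory.LatticeGaugeProofs

/-!
# The denominator of the lattice-QCD torus functional as a cyclic kernel supertrace
(crux `QuarksAsStableAction.StableActionBridge`, item stmt-QuantumFields-9737, line `Sketch`;
registered stub `integral_fermiBoltzmann_wilsonMeasure_eq_cyclic_supertrace`)

The STATEMENT's lattice-QCD expectation on the four-torus `(ℤ/N)⁴`, `qcdTorusExpect β N mq`, is a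
ratio whose denominator is the Wilson-measure average of the fermionic partition function in the
background field,

  `∫ dμ_W(U) ∫dψ̄dψ e^{−ψ̄ D(U) ψ}`,   `μ_W = Z_W⁻¹ e^{−β S_W(U)} ∏_e dU_e`,   `Z_W = ∫ e^{−β S_W} ∏_e dU_e`,

with `D(U) = diracMatrix U mq` the flavour-diagonal `r = 1` Wilson–Dirac matrix of `N_f` quark
flavours of bare masses `m_f > −1` (fundamental representation of `SU(3)`), time-PERIODIC in all four
directions.  This file identifies it with a transfer-matrix SUPERTRACE:

  `∫ dμ_W ∫dψ̄dψ e^{−ψ̄Dψ} = ε · (∫∫ ∏_t K_β(Us t, (Us (t+1))^{gs t}) · STr ∏_t T̂_F(Us t) Γ(G_{gs t}) dUs dgs) / Z_W`,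

where `ε = (−1)^{n(n−1)/2 + n}` (`n` = number of quark variables) is the fixed orientation sign of the
tree's Berezin integral (`∫dψ̄dψ e^{−ψ̄Dψ} = ε det D`, Montvay–Münster (4.17)), `K_β` is the
temporal-gauge transfer kernel of the gauge field (`gaugeSliceKernel`), `T̂_F` is Smit's `N_f`-flavour
fermionic transfer operator on the slice Fock space (`fermionSliceOp`, Smit (6.91)), `Γ(G_g)` the
Fock-space gauge rotation (`fockGaugeAct`) and `STr X = Σ_s (−1)^{#s} X_{ss}`.  The Haar integrals
over the temporal links `gs t` are the Gauss-law projections `P̂₀`, so this is Lüscher's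
`Z_QCD ∝ STr (𝕋 P̂₀)^N` for the statement's time-periodic Wilson quarks (periodic boundary
conditions in time give the supertrace, antiperiodic ones the trace: Montvay–Münster §4.1 after
(4.34)).

Assembly (pure theorem file, no definitions):
* `fermiIntegral_fermiBoltzmann`: `∫dψ̄dψ e^{−ψ̄D(U)ψ} = ε det D(U)` pointwise in `U`;
* `TorusDenominator.integral_wilsonMeasure_eq_div` (the general transport lemma, exposed for
  reuse): for a continuous representation `ρ` of a compact gauge group and ANY integrand `F`,
  `∫ F dμ_W = (∫ e^{−β S_W(U)} F(U) ∏ dU_e) / Z_W` — unfold `μ_W = Z_W⁻¹ • (Haar.withDensity e^{−βS_W})`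
  (`integral_smul_measure`, `integral_withDensity_eq_integral_toReal_smul`) and identify the
  `ENNReal` partition function with the real integral `Z_W` (the weight is continuous on the compact
  configuration space, hence integrable);
* the `N_f`-flavour capstone C `qcd_boltzmann_integral_eq_cyclic_supertrace_flavour`:
  `∫ e^{−β S_W(U)} det D(U) ∏ dU_e` is the cyclic kernel supertrace integral.

References: M. Lüscher, Commun. Math. Phys. 54 (1977) 283 [Luscher1977, pp. 283–292];
K. Osterwalder, E. Seiler, Ann. Phys. 110 (1978) 440 [OsterwalderSeiler1978, §2];
I. Montvay and G. Münster, *Quantum Fields on a Lattice* [MontvayMunster1994, §4.1 (4.17), (4.34)];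
J. Smit, *Introduction to Quantum Fields on a Lattice* [Smit2023, §6.5 (6.87)–(6.91)].
-/

noncomputable section

namespace Summit.QuantumFields.QCD.Cruxes.StableActionBridge.Sketch

open MeasureTheory Matrix Literature.MathematicalPhysics.QuantumFieldTheory
  Literature.MathematicalPhysics.QuantumLattice
open Literature.Probability.LatticeModels (TorusSite)

namespace TorusDenominator

variable {d n L : ℕ} [NeZero L] {G : Type*} [Group G] [TopologicalSpace G] [IsTopologicalGroup G]
  [CompactSpace G] [MeasurableSpace G] [BorelSpace G] [SecondCountableTopology G]
  {ρ : G →* Matrix (Fin n) (Fin n) ℂ}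

/-- **The partition function is the real Haar integral of the Boltzmann weight.**  For a continuous
representation `ρ` of the compact gauge group, the `ENNReal`-valued Wilson partition function of the
torus is `Z_W = ENNReal.ofReal (∫ e^{−β S_W(U)} ∏_e dU_e)` (the weight is continuous on the compact
configuration space, hence Haar integrable). [folklore] -/
theorem partitionFunction_eq_ofReal_integral (hρ : Continuous ρ) (β : ℝ) :
    partitionFunction (d := d) (L := L) ρ β =
      ENNReal.ofReal (∫ U, Real.exp (-(β * wilsonAction ρ U))
        ∂(Measure.pi fun _ : Edge d L => haarProbability G)) := by
  have hwc : Continuous fun U : GaugeConfig d L G => Real.exp (-(β * wilsonAction ρ U)) :=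
    Real.continuous_exp.comp
      ((Literature.MathematicalPhysics.QuantumFieldTheory.continuous_wilsonAction ρ hρ).const_mul
        β).neg
  have hwi : Integrable (fun U : GaugeConfig d L G => Real.exp (-(β * wilsonAction ρ U)))
      (Measure.pi fun _ : Edge d L => haarProbability G) :=
    hwc.integrable_of_hasCompactSupport (HasCompactSupport.of_compactSpace _)
  unfold partitionFunction wilsonWeight
  rw [withDensity_apply _ MeasurableSet.univ, Measure.restrict_univ,
    ofReal_integral_eq_lintegral_ofReal hwi (ae_of_all _ fun U => (Real.exp_pos _).le)]
  simp_rw [neg_mul]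

/-- **Transport of Wilson-measure integrals to Haar integrals (vector-valued form).**  For a
continuous representation `ρ` of the compact gauge group and ANY integrand `F` (no integrability
needed: both sides are the junk value simultaneously),
`∫ F dμ_W = Z_W⁻¹ • ∫ e^{−β S_W(U)} • F(U) ∏_e dU_e` with `Z_W = ∫ e^{−β S_W} ∏_e dU_e` the real
partition function: `μ_W = Z_W⁻¹ • Haar.withDensity e^{−β S_W}` by definition. [folklore] -/
theorem integral_wilsonMeasure_eq_inv_smul {E : Type*} [NormedAddCommGroup E] [NormedSpace ℝ E]
    (hρ : Continuous ρ) (β : ℝ) (F : GaugeConfig d L G → E) :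
    ∫ U, F U ∂(wilsonMeasure (d := d) (L := L) ρ β) =
      (∫ U, Real.exp (-(β * wilsonAction ρ U)) ∂(Measure.pi fun _ : Edge d L => haarProbability G))⁻¹ •
        ∫ U, Real.exp (-(β * wilsonAction ρ U)) • F U
          ∂(Measure.pi fun _ : Edge d L => haarProbability G) := by
  have hdm : Measurable fun U : GaugeConfig d L G =>
      ENNReal.ofReal (Real.exp (-β * wilsonAction ρ U)) :=
    ENNReal.measurable_ofReal.comp (Real.continuous_exp.comp (continuous_const.mul
      (Literature.MathematicalPhysics.QuantumFieldTheory.continuous_wilsonAction ρ hρ))).measurable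
  unfold wilsonMeasure
  rw [integral_smul_measure, partitionFunction_eq_ofReal_integral hρ β, ENNReal.toReal_inv,
    ENNReal.toReal_ofReal (integral_nonneg fun U => (Real.exp_pos _).le)]
  unfold wilsonWeight
  rw [integral_withDensity_eq_integral_toReal_smul hdm (ae_of_all _ fun U => ENNReal.ofReal_lt_top)]
  simp_rw [ENNReal.toReal_ofReal (Real.exp_pos _).le, neg_mul]

/-- **Transport of Wilson-measure integrals to Haar integrals (complex-valued quotient form).**  For
a continuous representation `ρ` of the compact gauge group and ANY complex integrand `F`,
`∫ F dμ_W = (∫ e^{−β S_W(U)} F(U) ∏_e dU_e) / ∫ e^{−β S_W(U)} ∏_e dU_e` (Seiler LNP 159 §1: torus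
expectations as ratios of Haar integrals). [folklore] -/
theorem integral_wilsonMeasure_eq_div (hρ : Continuous ρ) (β : ℝ) (F : GaugeConfig d L G → ℂ) :
    ∫ U, F U ∂(wilsonMeasure (d := d) (L := L) ρ β) =
      (∫ U, (Real.exp (-(β * wilsonAction ρ U)) : ℂ) * F U
          ∂(Measure.pi fun _ : Edge d L => haarProbability G)) /
        ((∫ U, Real.exp (-(β * wilsonAction ρ U))
          ∂(Measure.pi fun _ : Edge d L => haarProbability G) : ℝ) : ℂ) := by
  rw [integral_wilsonMeasure_eq_inv_smul hρ β F, Complex.real_smul, Complex.ofReal_inv,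
    inv_mul_eq_div]
  simp_rw [Complex.real_smul]

end TorusDenominator

/-- **The denominator of `qcdTorusExpect` as a transfer supertrace (stub
`integral_fermiBoltzmann_wilsonMeasure_eq_cyclic_supertrace` of line `Sketch`).**  For `N_f` flavours
of `r = 1` Wilson quarks of bare masses `m_f > −1` (fundamental representation of `SU(3)`) on the
four-torus `(ℤ/N)⁴` at inverse coupling `β`, the Wilson-measure average of the Berezin integral
`∫dψ̄dψ e^{−ψ̄ D(U) ψ}` equals the Berezin orientation sign `ε = (−1)^{n(n−1)/2+n}` times the cyclic
kernel supertrace `∫∫ ∏_t K_β(Us t, (Us (t+1))^{gs t}) · STr ∏_t T̂_F(Us t) Γ(G_{gs t}) dUs dgs` of `N`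
projected transfer kernels over the `N_f`-flavour slice Fock space, divided by the pure-gauge
partition function `Z_W = ∫ e^{−β S_W} ∏ dU_e`: Lüscher's `Z_QCD ∝ STr (𝕋 P̂₀)^N` for time-periodic
Wilson quarks. [cite: Luscher1977, pp. 283–292] [cite: OsterwalderSeiler1978, §2]
[cite: MontvayMunster1994, §4.1 (4.17), (4.34)] [cite: Smit2023, §6.5 (6.87)–(6.91)] -/
theorem integral_fermiBoltzmann_wilsonMeasure_eq_cyclic_supertrace : ∀ (Nf N : ℕ) [NeZero N] (β : ℝ) (mq : Fin Nf → ℝ), (∀ f, -1 < mq f) → ∫ U : GaugeConfig 4 N (Matrix.specialUnitaryGroup (Fin 3) ℂ), fermiIntegral (fermiBoltzmann U mq) ∂(wilsonMeasure (d := 4) (L := N) (fundamentalRep (Fin 3)) β) = (-1 : ℂ) ^ (Fintype.card (FermiIdx Nf N) * (Fintype.card (FermiIdx Nf N) - 1) / 2 + Fintype.card (FermiIdx Nf N)) * (∫ p : (ZMod N → GaugeConfig 3 N (Matrix.specialUnitaryGroup (Fin 3) ℂ)) × (ZMod N → TorusSite 3 N → Matrix.specialUnitaryGroup (Fin 3)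 ℂ), ((∏ t : ZMod N, gaugeSliceKernel β (p.1 t) (gaugeTransform (p.2 t) (p.1 (t + 1))) : ℝ) : ℂ) * ∑ s : Finset (SliceFermiIdx Nf N), (-1 : ℂ) ^ s.card * (((List.range N).map fun i : ℕ => fermionSliceOp (p.1 (i : ZMod N)) mq * fockGaugeAct (Nf := Nf) (p.2 (i : ZMod N))).prod) s s ∂((Measure.pi fun _ : ZMod N => Measure.pi fun _ : Edge 3 N => haarProbability (Matrix.specialUnitaryGroup (Fin 3) ℂ)).prod (Measure.pi fun _ : ZMod N => Measure.pi fun _ : TorusSite 3 N => haarProbability (Matrix.specialUnitaryGroup (Fin 3) ℂ)))) / ((∫ U : GaugeConfig 4 N (Matrix.specialUnitaryGroup (Fin 3) ℂ), Real.exp (-(β * wilsonAction (fundamentalRep (Fin 3)) U)) ∂(Measure.pi fun _ : Edge 4 N => haarProbability (Matrix.specialUnitaryGroup (Fin 3) ℂ)) : ℝ) : ℂ) := by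
  intro Nf N _ β mq hm
  simp only [fermiIntegral_fermiBoltzmann]
  rw [integral_const_mul, TorusDenominator.integral_wilsonMeasure_eq_div
      (continuous_fundamentalRep (Fin 3)) β (fun U => (diracMatrix U mq).det),
    qcd_boltzmann_integral_eq_cyclic_supertrace_flavour Nf N β mq hm, mul_div_assoc]

end Summit.QuantumFields.QCD.Cruxes.StableActionBridge.Sketch

end
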